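import Literature.Probability.LatticeModels.StrongHarrisKleitman
import Literature.Probability.Percolation.PercolationEvents
import HarnessLib

/-!
# Threshold-sunflower rows (glued three-point strong Harris) for the `NoHeavyLowerTail` LP lane

Helper file for crux `stmt-CriticalPhenomena-4575` (`NoHeavyLowerTail`, route `PercNearOneGluingNoHeavy`),
new-inequality factory seat `prim-ineq-gen-1`.  Everything here is PROVED from the tree's Gladkov strong
Harris–Kleitman inequality `Literature.Probability.LatticeModels.prodBernoulli_strongHarris`
(Gladkov, *Bull. Lond. Math. Soc.* 56 (2024), Thm. 2.1).

**Threshold sunflowers.**  For three increasing events `U₁, U₂, U₃` of a product measure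
`μ = prodBernoulli p` put `A₂ := {at least two of the Uᵢ hold}`, `N := {none holds}`,
`O_i := {only Uᵢ holds}`, `T := U₁ ∩ U₂ ∩ U₃`, `E_{ij} := {exactly Uᵢ, Uⱼ hold}`, `L := {at most one holds}`.
Then (threshold `m = 1` and `m = 2` of Gladkov's Thm. 2.1, cells `C_S = {exactly S}`):

* `μ(O₁)μ(O₂) + μ(O₁)μ(O₃) + μ(O₂)μ(O₃) ≤ μ(A₂) μ(N)`   (`prodBernoulli_threshold_one_of_three`),
* `μ(E₁₂)μ(E₁₃) + μ(E₁₂)μ(E₂₃) + μ(E₁₃)μ(E₂₃) ≤ μ(T) μ(L)`     (`prodBernoulli_threshold_two_of_three`).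

With `U₁ = {a↔b}, U₂ = {a↔c}, U₃ = {b↔c}` the first is the Aas–Gladkov three-point row
(`prodBernoulli_threePoint_strongHarris`); with GROUP connection events it is the three-point row of a
quotient graph (terminal groups glued to points, BHK 2006 Remark 1).  Percolation corollaries recorded for
the wf3lp 5-terminal model (observer `o`, relays `a₁ a₂ a₃`):

* `glued_threePoint_strongHarris` — points `o | {a₁,a₂} | a₃`:
  `U₁ = {o↔a₁} ∪ {o↔a₂}`, `U₂ = {a₃↔a₁} ∪ {a₃↔a₂}`, `U₃ = {o↔a₃}`;
* `pairCut_threshold_two` — `U_j = {the group {o,a_j} is joined to one of the other two relays}`, `m = 2`.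

These rows are violated by every pseudo-law of the wf3lp certificate lane published up to 2026-08-19
(run/shared/lean/prim/prim-ineq-gen-1/FINDING-TSF.md: e.g. the second by `−1.2·10⁻²` and the first by
`−7.9·10⁻³` on the vector `z*` that satisfies all two-set/Harris/ccBK/MIX/SHK/DT rows), so they are the
rows the LP lane was missing; they enter certificates as valid quadratic rows.
-/

noncomputable section

open MeasureTheory Literature.Probability.LatticeModels

namespace Summit.CriticalPhenomena.PercolationContinuityZ3.Theorems

namespace ThresholdSunflower

variable {ι : Type*} [Finite ι]

/-- **Threshold `m = 1` of three up-sets** (Gladkov 2024 BLMS Thm. 2.1 with `A = {≥ 2 of U₁,U₂,U₃}`,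
cells `Cᵢ = {only Uᵢ}`, `B = {none}`): for increasing `U₁ U₂ U₃ ⊆ Set ι` under `μ = prodBernoulli p`,
`μ(O₁)μ(O₂) + μ(O₁)μ(O₃) + μ(O₂)μ(O₃) ≤ μ(A₂)·μ(N)` where `Oᵢ = Uᵢ ∩ Uⱼᶜ ∩ Uₖᶜ`,
`A₂ = (U₁ ∩ U₂) ∪ (U₁ ∩ U₃) ∪ (U₂ ∩ U₃)`, `N = U₁ᶜ ∩ U₂ᶜ ∩ U₃ᶜ`.
[cite: Gladkov2024StrongFKG, Thm. 2.1] -/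
theorem prodBernoulli_threshold_one_of_three (p : ι → unitInterval) {U₁ U₂ U₃ : Set (Set ι)}
    (h₁ : IsUpperSet U₁) (h₂ : IsUpperSet U₂) (h₃ : IsUpperSet U₃) :
    (prodBernoulli p).real (U₁ ∩ U₂ᶜ ∩ U₃ᶜ) * (prodBernoulli p).real (U₂ ∩ U₁ᶜ ∩ U₃ᶜ) +
        (prodBernoulli p).real (U₁ ∩ U₂ᶜ ∩ U₃ᶜ) * (prodBernoulli p).real (U₃ ∩ U₁ᶜ ∩ U₂ᶜ) +
        (prodBernoulli p).real (U₂ ∩ U₁ᶜ ∩ U₃ᶜ) * (prodBernoulli p).real (U₃ ∩ U₁ᶜ ∩ U₂ᶜ) ≤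
      (prodBernoulli p).real ((U₁ ∩ U₂) ∪ (U₁ ∩ U₃) ∪ (U₂ ∩ U₃)) *
        (prodBernoulli p).real (U₁ᶜ ∩ U₂ᶜ ∩ U₃ᶜ) := by
  classical
  set A : Set (Set ι) := (U₁ ∩ U₂) ∪ (U₁ ∩ U₃) ∪ (U₂ ∩ U₃) with hA
  set C₀ : Set (Set ι) := U₁ ∩ U₂ᶜ ∩ U₃ᶜ with hC₀
  set C₁ : Set (Set ι) := U₂ ∩ U₁ᶜ ∩ U₃ᶜ with hC₁
  set C₂ : Set (Set ι) := U₃ ∩ U₁ᶜ ∩ U₂ᶜ with hC₂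
  have d01 : Disjoint C₀ C₁ := Set.disjoint_left.2 fun ω h0 h1 => h1.1.2 h0.1.1
  have d02 : Disjoint C₀ C₂ := Set.disjoint_left.2 fun ω h0 h2 => h2.1.2 h0.1.1
  have d12 : Disjoint C₁ C₂ := Set.disjoint_left.2 fun ω h1 h2 => h2.2 h1.1.1
  have dA0 : Disjoint A C₀ := Set.disjoint_left.2 fun ω hA' h0 => by
    rcases hA' with (⟨-, hb⟩ | ⟨-, hc⟩) | ⟨hb, -⟩
    · exact h0.1.2 hb
    · exact h0.2 hc
    · exact h0.1.2 hb
  have dA1 : Disjoint A C₁ := Set.disjoint_left.2 fun ω hA' h1 => by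
    rcases hA' with (⟨ha, -⟩ | ⟨ha, -⟩) | ⟨-, hc⟩
    · exact h1.1.2 ha
    · exact h1.1.2 ha
    · exact h1.2 hc
  have dA2 : Disjoint A C₂ := Set.disjoint_left.2 fun ω hA' h2 => by
    rcases hA' with (⟨ha, -⟩ | ⟨ha, -⟩) | ⟨hb, -⟩
    · exact h2.1.2 ha
    · exact h2.1.2 ha
    · exact h2.2 hb
  -- `A ∪ C₀ = U₁ ∪ (U₂ ∩ U₃)` etc. are increasing
  have hU0 : A ∪ C₀ = U₁ ∪ (U₂ ∩ U₃) := by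
    ext ω
    simp only [hA, hC₀, Set.mem_union, Set.mem_inter_iff, Set.mem_compl_iff]
    tauto
  have hU1 : A ∪ C₁ = U₂ ∪ (U₁ ∩ U₃) := by
    ext ω
    simp only [hA, hC₁, Set.mem_union, Set.mem_inter_iff, Set.mem_compl_iff]
    tauto
  have hU2 : A ∪ C₂ = U₃ ∪ (U₁ ∩ U₂) := by
    ext ω
    simp only [hA, hC₂, Set.mem_union, Set.mem_inter_iff, Set.mem_compl_iff]
    tauto
  have up0 : IsUpperSet (A ∪ C₀) := by rw [hU0]; exact h₁.union (h₂.inter h₃)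
  have up1 : IsUpperSet (A ∪ C₁) := by rw [hU1]; exact h₂.union (h₁.inter h₃)
  have up2 : IsUpperSet (A ∪ C₂) := by rw [hU2]; exact h₃.union (h₁.inter h₂)
  have hAup : IsUpperSet A := ((h₁.inter h₂).union (h₁.inter h₃)).union (h₂.inter h₃)
  let C : Fin 3 → Set (Set ι) := ![C₀, C₁, C₂]
  have e0 : C 0 = C₀ := rfl
  have e1 : C 1 = C₁ := rfl
  have e2 : C 2 = C₂ := rfl
  have hdisj : ∀ i ∈ (Finset.univ : Finset (Fin 3)), ∀ j ∈ (Finset.univ : Finset (Fin 3)),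
      i ≠ j → Disjoint (C i) (C j) := by
    intro i _ j _ hij
    fin_cases i <;> fin_cases j
    all_goals first
      | exact (hij rfl).elim
      | exact d01 | exact d01.symm | exact d02 | exact d02.symm | exact d12 | exact d12.symm
  have hdisjA : ∀ i ∈ (Finset.univ : Finset (Fin 3)), Disjoint A (C i) := by
    intro i _
    fin_cases i
    · exact dA0
    · exact dA1
    · exact dA2
  have hup : ∀ i ∈ (Finset.univ : Finset (Fin 3)), IsUpperSet (A ∪ C i) := by
    intro i _
    fin_cases i
    · exact up0
    · exact up1
    · exact up2
  have key := prodBernoulli_strongHarris p (Finset.univ : Finset (Fin 3)) hdisj hdisjA hup hAup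
  have hB : (A ∪ ⋃ i ∈ (Finset.univ : Finset (Fin 3)), C i)ᶜ = U₁ᶜ ∩ U₂ᶜ ∩ U₃ᶜ := by
    have h3 : (⋃ i ∈ (Finset.univ : Finset (Fin 3)), C i) = C₀ ∪ C₁ ∪ C₂ := by
      ext ω
      simp only [Finset.mem_univ, Set.iUnion_true, Set.mem_iUnion, Set.mem_union]
      constructor
      · rintro ⟨i, hi⟩
        fin_cases i
        · exact Or.inl (Or.inl hi)
        · exact Or.inl (Or.inr hi)
        · exact Or.inr hi
      · rintro ((h | h) | h)
        · exact ⟨0, h⟩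
        · exact ⟨1, h⟩
        · exact ⟨2, h⟩
    rw [h3]
    ext ω
    simp only [hA, hC₀, hC₁, hC₂, Set.mem_compl_iff, Set.mem_union, Set.mem_inter_iff]
    tauto
  rw [hB] at key
  simp only [Fin.sum_univ_three, e0, e1, e2] at key
  nlinarith [key]

/-- **Threshold `m = 2` of three up-sets** (Gladkov 2024 BLMS Thm. 2.1 with `A = U₁ ∩ U₂ ∩ U₃`, cells
`C_{ij} = {exactly Uᵢ, Uⱼ}`, `B = {at most one}`): for increasing `U₁ U₂ U₃ ⊆ Set ι` under
`μ = prodBernoulli p`, writing `E₁₂ = U₁ ∩ U₂ ∩ U₃ᶜ` etc. and `L = {at most one of the Uᵢ}`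
(the complement of `(U₁ ∩ U₂) ∪ (U₁ ∩ U₃) ∪ (U₂ ∩ U₃)`),
`μ(E₁₂)μ(E₁₃) + μ(E₁₂)μ(E₂₃) + μ(E₁₃)μ(E₂₃) ≤ μ(U₁ ∩ U₂ ∩ U₃)·μ(L)`.
[cite: Gladkov2024StrongFKG, Thm. 2.1] -/
theorem prodBernoulli_threshold_two_of_three (p : ι → unitInterval) {U₁ U₂ U₃ : Set (Set ι)}
    (h₁ : IsUpperSet U₁) (h₂ : IsUpperSet U₂) (h₃ : IsUpperSet U₃) :
    (prodBernoulli p).real (U₁ ∩ U₂ ∩ U₃ᶜ) * (prodBernoulli p).real (U₁ ∩ U₃ ∩ U₂ᶜ) +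
        (prodBernoulli p).real (U₁ ∩ U₂ ∩ U₃ᶜ) * (prodBernoulli p).real (U₂ ∩ U₃ ∩ U₁ᶜ) +
        (prodBernoulli p).real (U₁ ∩ U₃ ∩ U₂ᶜ) * (prodBernoulli p).real (U₂ ∩ U₃ ∩ U₁ᶜ) ≤
      (prodBernoulli p).real (U₁ ∩ U₂ ∩ U₃) *
        (prodBernoulli p).real ((U₁ ∩ U₂) ∪ (U₁ ∩ U₃) ∪ (U₂ ∩ U₃))ᶜ := by
  classical
  set A : Set (Set ι) := U₁ ∩ U₂ ∩ U₃ with hA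
  set C₀ : Set (Set ι) := U₁ ∩ U₂ ∩ U₃ᶜ with hC₀
  set C₁ : Set (Set ι) := U₁ ∩ U₃ ∩ U₂ᶜ with hC₁
  set C₂ : Set (Set ι) := U₂ ∩ U₃ ∩ U₁ᶜ with hC₂
  have d01 : Disjoint C₀ C₁ := Set.disjoint_left.2 fun ω h0 h1 => h0.2 h1.1.2
  have d02 : Disjoint C₀ C₂ := Set.disjoint_left.2 fun ω h0 h2 => h0.2 h2.1.2
  have d12 : Disjoint C₁ C₂ := Set.disjoint_left.2 fun ω h1 h2 => h2.2 h1.1.1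
  have dA0 : Disjoint A C₀ := Set.disjoint_left.2 fun ω hA' h0 => h0.2 hA'.2
  have dA1 : Disjoint A C₁ := Set.disjoint_left.2 fun ω hA' h1 => h1.2 hA'.1.2
  have dA2 : Disjoint A C₂ := Set.disjoint_left.2 fun ω hA' h2 => h2.2 hA'.1.1
  have hU0 : A ∪ C₀ = U₁ ∩ U₂ := by
    ext ω
    simp only [hA, hC₀, Set.mem_union, Set.mem_inter_iff, Set.mem_compl_iff]
    tauto
  have hU1 : A ∪ C₁ = U₁ ∩ U₃ := by
    ext ω
    simp only [hA, hC₁, Set.mem_union, Set.mem_inter_iff, Set.mem_compl_iff]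
    tauto
  have hU2 : A ∪ C₂ = U₂ ∩ U₃ := by
    ext ω
    simp only [hA, hC₂, Set.mem_union, Set.mem_inter_iff, Set.mem_compl_iff]
    tauto
  have up0 : IsUpperSet (A ∪ C₀) := by rw [hU0]; exact h₁.inter h₂
  have up1 : IsUpperSet (A ∪ C₁) := by rw [hU1]; exact h₁.inter h₃
  have up2 : IsUpperSet (A ∪ C₂) := by rw [hU2]; exact h₂.inter h₃
  have hAup : IsUpperSet A := (h₁.inter h₂).inter h₃
  let C : Fin 3 → Set (Set ι) := ![C₀, C₁, C₂]
  have e0 : C 0 = C₀ := rfl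
  have e1 : C 1 = C₁ := rfl
  have e2 : C 2 = C₂ := rfl
  have hdisj : ∀ i ∈ (Finset.univ : Finset (Fin 3)), ∀ j ∈ (Finset.univ : Finset (Fin 3)),
      i ≠ j → Disjoint (C i) (C j) := by
    intro i _ j _ hij
    fin_cases i <;> fin_cases j
    all_goals first
      | exact (hij rfl).elim
      | exact d01 | exact d01.symm | exact d02 | exact d02.symm | exact d12 | exact d12.symm
  have hdisjA : ∀ i ∈ (Finset.univ : Finset (Fin 3)), Disjoint A (C i) := by
    intro i _
    fin_cases i
    · exact dA0
    · exact dA1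
    · exact dA2
  have hup : ∀ i ∈ (Finset.univ : Finset (Fin 3)), IsUpperSet (A ∪ C i) := by
    intro i _
    fin_cases i
    · exact up0
    · exact up1
    · exact up2
  have key := prodBernoulli_strongHarris p (Finset.univ : Finset (Fin 3)) hdisj hdisjA hup hAup
  have hB : (A ∪ ⋃ i ∈ (Finset.univ : Finset (Fin 3)), C i)ᶜ =
      ((U₁ ∩ U₂) ∪ (U₁ ∩ U₃) ∪ (U₂ ∩ U₃))ᶜ := by
    have h3 : (⋃ i ∈ (Finset.univ : Finset (Fin 3)), C i) = C₀ ∪ C₁ ∪ C₂ := by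
      ext ω
      simp only [Finset.mem_univ, Set.iUnion_true, Set.mem_iUnion, Set.mem_union]
      constructor
      · rintro ⟨i, hi⟩
        fin_cases i
        · exact Or.inl (Or.inl hi)
        · exact Or.inl (Or.inr hi)
        · exact Or.inr hi
      · rintro ((h | h) | h)
        · exact ⟨0, h⟩
        · exact ⟨1, h⟩
        · exact ⟨2, h⟩
    rw [h3]
    ext ω
    simp only [hA, hC₀, hC₁, hC₂, Set.mem_compl_iff, Set.mem_union, Set.mem_inter_iff]
    tauto
  rw [hB] at key
  simp only [Fin.sum_univ_three, e0, e1, e2] at key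
  nlinarith [key]

end ThresholdSunflower

open Literature.Probability.Percolation ThresholdSunflower

variable {V : Type*} [Finite V]

/-- **Glued three-point strong-Harris row** (points `o | {a₁,a₂} | a₃` of the quotient graph in which the
relays `a₁, a₂` are identified; = `prodBernoulli_threshold_one_of_three` with the group-connection events
`U₁ = {o↔a₁} ∪ {o↔a₂}`, `U₂ = {a₃↔a₁} ∪ {a₃↔a₂}`, `U₃ = {o↔a₃}`).  For bond percolation
`μ = prodBernoulli w` with arbitrary edge weights on a finite vertex type:
`μ(O₁)μ(O₂) + μ(O₁)μ(O₃) + μ(O₂)μ(O₃) ≤ μ(≥2)·μ(none)` in the notation of that lemma.  On the wf3lp pseudo-law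
`z*` (KN Question 7 at `|A| = 3`) the left side exceeds the right side by `7.9·10⁻³`.
[cite: Gladkov2024StrongFKG, Thm. 2.1; VandenbergHaggstromKahn2005, Remark 1 (gluing)] -/
theorem glued_threePoint_strongHarris (w : Sym2 V → unitInterval) (o a₁ a₂ a₃ : V) :
    let U₁ : Set (BondConfig V) := openConn o a₁ ∪ openConn o a₂
    let U₂ : Set (BondConfig V) := openConn a₃ a₁ ∪ openConn a₃ a₂
    let U₃ : Set (BondConfig V) := openConn o a₃
    (prodBernoulli w).real (U₁ ∩ U₂ᶜ ∩ U₃ᶜ) * (prodBernoulli w).real (U₂ ∩ U₁ᶜ ∩ U₃ᶜ) +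
        (prodBernoulli w).real (U₁ ∩ U₂ᶜ ∩ U₃ᶜ) * (prodBernoulli w).real (U₃ ∩ U₁ᶜ ∩ U₂ᶜ) +
        (prodBernoulli w).real (U₂ ∩ U₁ᶜ ∩ U₃ᶜ) * (prodBernoulli w).real (U₃ ∩ U₁ᶜ ∩ U₂ᶜ) ≤
      (prodBernoulli w).real ((U₁ ∩ U₂) ∪ (U₁ ∩ U₃) ∪ (U₂ ∩ U₃)) *
        (prodBernoulli w).real (U₁ᶜ ∩ U₂ᶜ ∩ U₃ᶜ) := by
  intro U₁ U₂ U₃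
  exact prodBernoulli_threshold_one_of_three w
    ((isUpperSet_openConn o a₁).union (isUpperSet_openConn o a₂))
    ((isUpperSet_openConn a₃ a₁).union (isUpperSet_openConn a₃ a₂)) (isUpperSet_openConn o a₃)

/-- **Pair-cut threshold row** (`m = 2`): with `U_j := {the group {o, a_j} is joined to one of the two other
relays}` (`j = 1,2,3`; each a union of four connection events, increasing),
`μ(E₁₂)μ(E₁₃) + μ(E₁₂)μ(E₂₃) + μ(E₁₃)μ(E₂₃) ≤ μ(U₁ ∩ U₂ ∩ U₃)·μ(at most one U_j)` — the strongest
threshold-sunflower row against the wf3lp pseudo-law `z*` (violated there by `1.2·10⁻²`).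
[cite: Gladkov2024StrongFKG, Thm. 2.1] -/
theorem pairCut_threshold_two (w : Sym2 V → unitInterval) (o a₁ a₂ a₃ : V) :
    let U₁ : Set (BondConfig V) := openConn o a₂ ∪ openConn o a₃ ∪ openConn a₁ a₂ ∪ openConn a₁ a₃
    let U₂ : Set (BondConfig V) := openConn o a₁ ∪ openConn o a₃ ∪ openConn a₂ a₁ ∪ openConn a₂ a₃
    let U₃ : Set (BondConfig V) := openConn o a₁ ∪ openConn o a₂ ∪ openConn a₃ a₁ ∪ openConn a₃ a₂
    (prodBernoulli w).real (U₁ ∩ U₂ ∩ U₃ᶜ) * (prodBernoulli w).real (U₁ ∩ U₃ ∩ U₂ᶜ) +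
        (prodBernoulli w).real (U₁ ∩ U₂ ∩ U₃ᶜ) * (prodBernoulli w).real (U₂ ∩ U₃ ∩ U₁ᶜ) +
        (prodBernoulli w).real (U₁ ∩ U₃ ∩ U₂ᶜ) * (prodBernoulli w).real (U₂ ∩ U₃ ∩ U₁ᶜ) ≤
      (prodBernoulli w).real (U₁ ∩ U₂ ∩ U₃) *
        (prodBernoulli w).real ((U₁ ∩ U₂) ∪ (U₁ ∩ U₃) ∪ (U₂ ∩ U₃))ᶜ := by
  intro U₁ U₂ U₃
  have hU : ∀ x y z s t u v r : V, IsUpperSet (openConn x y ∪ openConn z s ∪ openConn t u ∪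
      openConn v r : Set (BondConfig V)) := fun x y z s t u v r =>
    (((isUpperSet_openConn x y).union (isUpperSet_openConn z s)).union
      (isUpperSet_openConn t u)).union (isUpperSet_openConn v r)
  exact prodBernoulli_threshold_two_of_three w (hU _ _ _ _ _ _ _ _) (hU _ _ _ _ _ _ _ _)
    (hU _ _ _ _ _ _ _ _)

end Summit.CriticalPhenomena.PercolationContinuityZ3.Theorems

end
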